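import Literature.InformationTheory.QuantumCodes.LocalCodeEnergyBarrier
import Literature.InformationTheory.QuantumCodes.SubsystemCodes
import HarnessLib

/-!
# Bravyi–Terhal 2009, §3.2: the energy barrier is at most linear in the weight, `d‡ = O(d)` — proof

S. Bravyi, B. Terhal, arXiv:0810.1983 [BravyiTerhal2009], §3.2 (chunk p0013 L44–49 and L69–76): «`ε(E) ≤ 2 #{a :
E G_a = −G_a E}`. Summarizing we can bound the energy cost of `E` by (twice) the number of terms in the Hamiltonian
anti-commuting with `E` … Using Eq. (ubound) we can also show that `d‡ = O(d)`. Indeed, choose a non-trivial logical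
operator `P = P_{u_1} ⋯ P_{u_d} ∈ 𝒞(𝒮)∖𝒢` with weight `d`. The number of generators `G_a` anti-commuting with any
single-qubit operator `P_{u_i}` is at most `O(1)`. Therefore the number of generators anti-commuting with `P` is at most
`O(d)`. Implementing the sequence of the single-qubit Pauli operators `P_{u_1},…,P_{u_d}` in an arbitrary order one
gets a walk `γ ∈ 𝒲(I,P)` with `ε_max(γ) = O(1)`» [sic; the displayed claim is `d‡ = O(d)`: every partial product has
at most `O(d)` anticommuting terms].

THIS FILE PROVES the bound for the tree's combinatorial energy cost `energyCost g E = 2 #{a : ⟨g_a, E⟩ = 1}` of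
`LocalCodeEnergyBarrier.lean` (which IS the printed upper bound (ubound) for a general Hamiltonian `H = −Σ_a G_a` and
the exact cost for stabilizer Hamiltonians): for ANY family `g` in which every qubit meets at most `g_max` terms and
ANY Pauli class `E`, implementing `E` qubit by qubit (in any injective order `ℓ`) never costs more than
`2 · g_max · wt(E)`: `energyCost_prefixWalk_le_weight`, and the walk form `exists_walk_energyCost_le_weight`
(so `d‡ ≤ 2 g_max d` for a code with a dressed logical operator of weight `d`: `BravyiTerhal2009_energyBarrier_le_linear`).

## Mathlib / tree search

Tree: `energyCost`, `IsPauliWalk`, `EnergyBarrier.{prefixWalk, prefixWalk_zero, prefixWalk_of_forall_lt,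
sympWeight_prefixWalk_step}` (LocalCodeEnergyBarrier.lean); `sympSupport`, `card_sympSupport` (LocalityBounds.lean);
`gaugeStabilizer` (SubsystemCodes.lean). No prior linear bound in the tree.
-/

namespace Literature.InformationTheory.QuantumCodes

open Finset
open Classical

variable {n : ℕ}

namespace EnergyBarrier

/-- A term anticommuting with a partially implemented `E` meets the support of `E` (the partial operator is
supported inside `supp E`). [cite: BravyiTerhal2009, §3.2 (p. 13: «The number of generators G_a anti-commuting with any single-qubit operator P_{u_i} is at most O(1)»)] -/
theorem exists_mem_sympSupport_of_anticommute_prefixWalk {ℓ : Fin n → ℕ} {E u : SympVec n} {i : ℕ}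
    (h : sympInner u (prefixWalk ℓ E i) ≠ 0) : ∃ q ∈ sympSupport u, q ∈ sympSupport E := by
  by_contra hne
  push Not at hne
  apply h
  unfold sympInner dotProduct
  have h0 : ∀ q, u.1 q * (prefixWalk ℓ E i).2 q = 0 ∧ (prefixWalk ℓ E i).1 q * u.2 q = 0 := by
    intro q
    by_cases hq : q ∈ sympSupport u
    · have hqE := hne q hq
      simp only [sympSupport, mem_filter, mem_univ, true_and, not_or, not_not] at hqE
      simp [prefixWalk, hqE.1, hqE.2]
    · simp only [sympSupport, mem_filter, mem_univ, true_and, not_or, not_not] at hq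
      simp [hq.1, hq.2]
  simp [h0]

/-- **`ε ≤ 2 g_max · wt(E)` along any single-qubit implementation of `E`.** For any family of terms `g` with at
most `g_max` terms per qubit, every prefix `ρ_{U_i} E` of `E` along any labelling has
`energyCost g (ρ_{U_i} E) ≤ 2 · g_max · wt(E)`. [cite: BravyiTerhal2009, §3.2 (p. 13: «the number of generators anti-commuting with P is at most O(d)»)] -/
theorem energyCost_prefixWalk_le_weight {ι : Type*} [Fintype ι] {g : ι → SympVec n} {gmax : ℕ}
    (hdeg : ∀ q : Fin n, #(univ.filter fun a => q ∈ sympSupport (g a)) ≤ gmax) (ℓ : Fin n → ℕ) (E : SympVec n)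
    (i : ℕ) : energyCost g (prefixWalk ℓ E i) ≤ 2 * gmax * sympWeight E := by
  unfold energyCost
  have hsub : (univ.filter fun a => sympInner (g a) (prefixWalk ℓ E i) ≠ 0) ⊆
      (sympSupport E).biUnion (fun q => univ.filter fun a => q ∈ sympSupport (g a)) := by
    intro a ha
    simp only [mem_filter, mem_univ, true_and] at ha
    obtain ⟨q, hqa, hqE⟩ := exists_mem_sympSupport_of_anticommute_prefixWalk ha
    rw [mem_biUnion]
    exact ⟨q, hqE, by simpa using hqa⟩
  calc 2 * #(univ.filter fun a => sympInner (g a) (prefixWalk ℓ E i) ≠ 0)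
      ≤ 2 * #((sympSupport E).biUnion fun q => univ.filter fun a => q ∈ sympSupport (g a)) :=
        Nat.mul_le_mul_left _ (card_le_card hsub)
    _ ≤ 2 * ∑ q ∈ sympSupport E, #(univ.filter fun a => q ∈ sympSupport (g a)) :=
        Nat.mul_le_mul_left _ card_biUnion_le
    _ ≤ 2 * ∑ _q ∈ sympSupport E, gmax := Nat.mul_le_mul_left _ (sum_le_sum fun q _ => hdeg q)
    _ = 2 * gmax * sympWeight E := by rw [sum_const, smul_eq_mul, card_sympSupport]; ring

/-- **Walk form**: every Pauli class `E` is reached from the identity by a walk on the Pauli group (one qubit at a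
time, in the order of the qubit indices) along which the energy cost never exceeds `2 · g_max · wt(E)`.
[cite: BravyiTerhal2009, §3.2 (p. 13: «Implementing the sequence of the single-qubit Pauli operators P_{u_1},…,P_{u_d} in an arbitrary order one gets a walk γ ∈ 𝒲(I,P)»)] -/
theorem exists_walk_energyCost_le_weight {ι : Type*} [Fintype ι] {g : ι → SympVec n} {gmax : ℕ}
    (hdeg : ∀ q : Fin n, #(univ.filter fun a => q ∈ sympSupport (g a)) ≤ gmax) (E : SympVec n) :
    ∃ (m : ℕ) (γ : Fin (m + 1) → SympVec n), γ 0 = 0 ∧ γ (Fin.last m) = E ∧ IsPauliWalk γ ∧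
      ∀ i, energyCost g (γ i) ≤ 2 * gmax * sympWeight E := by
  refine ⟨n, fun i => prefixWalk (fun q : Fin n => (q : ℕ)) E i, ?_, ?_, ?_, fun i => ?_⟩
  · simp only [Fin.val_zero]
    exact prefixWalk_zero
  · simp only [Fin.val_last]
    exact prefixWalk_of_forall_lt fun q => q.isLt
  · intro i
    simp only [Fin.val_castSucc, Fin.val_succ]
    exact sympWeight_prefixWalk_step Fin.val_injective i
  · exact energyCost_prefixWalk_le_weight hdeg _ E i

end EnergyBarrier

open EnergyBarrier in
/-- **Bravyi–Terhal 2009, §3.2: `d‡ = O(d)` — proved, quantitative.** For the Hamiltonian `H = Σ_a r_a G_a` with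
terms `g_a` (any family, at most `g_max` terms per qubit) and any subsystem code `Ḡ` with a dressed logical operator
`P ∈ S̄⊥ ∖ Ḡ` of weight `d` (e.g. a minimum-weight one), there is a walk `0 = P_0, …, P_m = P` on the Pauli group with
(the combinatorial upper bound on) the energy cost `≤ 2 g_max · d` at every step; so the energy barrier is at most
linear in the distance. Column: proved theorem. [cite: BravyiTerhal2009, §3.2 (p. 13: «Using Eq. (ubound) we can also show that d‡ = O(d)»)] -/
theorem BravyiTerhal2009_energyBarrier_le_linear {ι : Type*} [Fintype ι] (g : ι → SympVec n) {gmax : ℕ}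
    (hdeg : ∀ q : Fin n, #(univ.filter fun a => q ∈ sympSupport (g a)) ≤ gmax)
    (G : Submodule (ZMod 2) (SympVec n)) {P : SympVec n} (hP : P ∈ sympDual (gaugeStabilizer G)) (hPG : P ∉ G) :
    ∃ E ∈ sympDual (gaugeStabilizer G), E ∉ G ∧ ∃ (m : ℕ) (γ : Fin (m + 1) → SympVec n),
      γ 0 = 0 ∧ γ (Fin.last m) = E ∧ IsPauliWalk γ ∧ ∀ i, energyCost g (γ i) ≤ 2 * gmax * sympWeight P := by
  obtain ⟨m, γ, h0, h1, hw, he⟩ := exists_walk_energyCost_le_weight hdeg P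
  exact ⟨P, hP, hPG, m, γ, h0, h1, hw, he⟩

end Literature.InformationTheory.QuantumCodes
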